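import Literature.Analysis.FunctionSpaces.TorusTransportFluxKernel
import Mathlib.MeasureTheory.Group.Integral
import HarnessLib

/-!
# The weighted transport flux: symmetrisation and the double-difference (Constantin–E–Titi / DiPerna–Lions) form

Analysis/FunctionSpaces support file (everything proved; no definitions, no named facts).  Continues
`TorusTransportFluxKernel`, where the transport flux of the weighted Galerkin identity
`Fl(ω) = Σ_{k∈F} ω_k Re Σ_a 2πi k_a ⟪𝓕(b_a w)(k), ŵ(k)⟫` (`w ∈ L²(𝕋^d; ℝ^d)`, `b` continuous, `ω` real on a finite `F`)
was written as `∫∫ ⟨w(x), w(y)⟩ b(y)·∇K_ω(y − x) dx dy` against the gradient kernel `∇K_ω = fluxKernelGrad F ω`.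

* `integral_prod_drift_eq_half_symm` — SYMMETRISATION (the kernel is odd; swap the variables):
  `∫∫ ⟨w(x),w(y)⟩ b(y)·∇K_ω(y−x) = ½ ∫∫ ⟨w(x),w(y)⟩ (b(y) − b(x))·∇K_ω(y−x)`;
* `integral_sum_mul_fluxKernelGrad_sub_eq_zero` — a weakly divergence-free drift pairs to zero with the
  gradient kernel: `∫ b(y)·∇K_ω(y − x) dy = 0` (`Σ_a k_a b̂_a(−k) = 0`);
* `integral_prod_norm_sq_mul_symmDrift_eq_zero` — hence the squares in
  `⟨w(x),w(y)⟩ = ½(|w(x)|² + |w(y)|² − |w(x) − w(y)|²)` integrate to zero (`∫∇K_ω = 0`);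
* `weightedFlux_eq_neg_quarter_integral` — THE DOUBLE-DIFFERENCE FORM
  `Fl(ω) = −¼ ∫∫ |w(x) − w(y)|² (b(y) − b(x))·∇K_ω(y − x) dx dy`
  (the structure of CET's `r_ε(f,g)(x) = ∫ k_ε(y)(δ_y f)(δ_y g)` and of DiPerna–Lions' commutator lemma, for a
  Fourier cutoff in place of a mollifier; the tree's mollifier version is `TorusCommutatorEstimate`);
The Lipschitz bound `|Fl(ω)| ≤ ¼ · L · ‖∇w‖² · ∫ ‖reprc z‖³ Σ_a |∇K_ω(z)_a| dz` (shear + translation estimate) is the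
companion file `TorusTransportFluxBound`.

Consumer: cell `ad-ideate`, K1L_D `stmt-AnomalousDissipation-27980`, W3-E `stub_effectiveFrameEnergyL` (i) — the
two-weight Lyapunov functional (crux memo `Lines/onelevel-W3E-k3l-lyapunov.md`, re-plan P1); remaining analytic input
is the kernel moment `∫‖reprc z‖³|∇K_ω(z)| ≲ ε²` for the dissipation-scale profile (P2).

## Mathlib / tree search
Tree: `TorusTransportFluxKernel` (kernel, `weightedFlux_eq_integral_prod`),
`TorusTrigPoly` (`IsWeaklyDivFree.sum_mul_mFourierCoeff_eq_zero`, `integral_mFourier_neg_mul_coord`).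
Mathlib: `integral_prod_swap`, `integral_prod(_symm)`, `integral_sub_right_eq_self`, `Integrable.mul_prod`.

## References
* P. Constantin, W. E, E. S. Titi, Comm. Math. Phys. 165 (1994), (9)–(10). [`ConstantinETiti1994`]
* R. J. DiPerna, P.-L. Lions, Invent. Math. 98 (1989), §II.1, Lemma II.1. [`DiPernaLions1989`]
-/

noncomputable section

open MeasureTheory Set Filter Complex UnitAddTorus Function
open scoped ENNReal InnerProductSpace ComplexConjugate

namespace Literature.Analysis.FunctionSpaces

namespace Torus

variable {d : Type*} [Fintype d]

/-! ## §0 File-local helpers -/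

/-- `|e_k(z)| = 1` (file-local copy of `TorusRieszFischerParam.norm_mFourier_apply`). [folklore] -/
private theorem norm_mFourier_apply' (n : d → ℤ) (x : UnitAddTorus d) : ‖mFourier n x‖ = 1 := by
  simp [mFourier]

/-- `e_k(y − x) = e_k(y) e_{−k}(x)` (file-local). [folklore] -/
private theorem mFourier_sub_eq (k : d → ℤ) (x y : UnitAddTorus d) :
    mFourier k (y - x) = mFourier k y * mFourier (-k) x := by
  have h1 : mFourier k (y - x) * mFourier k x = mFourier k y := by
    rw [← mFourier_apply_add, sub_add_cancel]
  have h2 : mFourier k x * mFourier (-k) x = 1 := by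
    rw [mFourier_neg, Complex.mul_conj, Complex.normSq_eq_norm_sq, norm_mFourier_apply']
    simp
  calc mFourier k (y - x) = mFourier k (y - x) * (mFourier k x * mFourier (-k) x) := by rw [h2, mul_one]
    _ = mFourier k y * mFourier (-k) x := by rw [← mul_assoc, h1]


/-! ## §1 Symmetrisation, the double-difference form, and the Lipschitz bound -/

section Symm

variable {w b : UnitAddTorus d → EuclideanSpace ℝ d}

/-- Integrability on `𝕋 × 𝕋` of `⟨w(x), w(y)⟩ g(x,y)` for `w ∈ L²` and `g` continuous. [folklore] -/
private theorem integrable_inner_mul (hw : MemLp w 2 volume) {g : UnitAddTorus d × UnitAddTorus d → ℝ}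
    (hg : Continuous g) : Integrable (fun z : UnitAddTorus d × UnitAddTorus d => ⟪w z.1, w z.2⟫_ℝ * g z) volume := by
  have hwi : Integrable w volume := hw.integrable one_le_two
  obtain ⟨C, hC⟩ := (isCompact_univ.image hg).isBounded.exists_norm_le
  have hww : Integrable (fun z : UnitAddTorus d × UnitAddTorus d => ‖w z.1‖ * ‖w z.2‖) volume := by
    rw [Measure.volume_eq_prod]; exact hwi.norm.mul_prod hwi.norm
  have hm : AEStronglyMeasurable (fun z : UnitAddTorus d × UnitAddTorus d => ⟪w z.1, w z.2⟫_ℝ * g z) volume := by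
    refine (AEStronglyMeasurable.inner ?_ ?_).mul hg.aestronglyMeasurable
    · exact hw.1.comp_quasiMeasurePreserving (Measure.volume_eq_prod (α := UnitAddTorus d) (β := UnitAddTorus d) ▸
        Measure.quasiMeasurePreserving_fst)
    · exact hw.1.comp_quasiMeasurePreserving (Measure.volume_eq_prod (α := UnitAddTorus d) (β := UnitAddTorus d) ▸
        Measure.quasiMeasurePreserving_snd)
  refine Integrable.mono' (hww.mul_const C) hm (ae_of_all _ fun z => ?_)
  rw [norm_mul, Real.norm_eq_abs, Real.norm_eq_abs]
  exact mul_le_mul (abs_real_inner_le_norm _ _) (Real.norm_eq_abs _ ▸ hC _ ⟨z, Set.mem_univ _, rfl⟩) (abs_nonneg _)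
    (mul_nonneg (norm_nonneg _) (norm_nonneg _))

/-- Integrability on `𝕋 × 𝕋` of `‖w(x)‖² g(x,y)` and of `‖w(y)‖² g(x,y)` for `w ∈ L²`, `g` continuous. [folklore] -/
private theorem integrable_norm_sq_mul (hw : MemLp w 2 volume) {g : UnitAddTorus d × UnitAddTorus d → ℝ}
    (hg : Continuous g) :
    Integrable (fun z : UnitAddTorus d × UnitAddTorus d => ‖w z.1‖ ^ 2 * g z) volume ∧
      Integrable (fun z : UnitAddTorus d × UnitAddTorus d => ‖w z.2‖ ^ 2 * g z) volume := by
  obtain ⟨C, hC⟩ := (isCompact_univ.image hg).isBounded.exists_norm_le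
  have h2 : Integrable (fun x => ‖w x‖ ^ 2) volume := hw.integrable_norm_pow two_ne_zero
  have h1 : Integrable (fun z : UnitAddTorus d × UnitAddTorus d => ‖w z.1‖ ^ 2 * (1 : ℝ)) volume := by
    rw [Measure.volume_eq_prod]; exact h2.mul_prod (integrable_const 1)
  have h1' : Integrable (fun z : UnitAddTorus d × UnitAddTorus d => (1 : ℝ) * ‖w z.2‖ ^ 2) volume := by
    rw [Measure.volume_eq_prod]; exact (integrable_const (1:ℝ)).mul_prod h2
  have hgm := hg.aestronglyMeasurable (μ := (volume : Measure (UnitAddTorus d × UnitAddTorus d)))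
  constructor
  · refine Integrable.mono' (h1.mul_const C) ((h1.1.mul hgm).congr (ae_of_all _ fun z => by simp))
      (ae_of_all _ fun z => ?_)
    rw [norm_mul, Real.norm_eq_abs, abs_of_nonneg (sq_nonneg _), mul_one]
    exact mul_le_mul_of_nonneg_left (hC _ ⟨z, Set.mem_univ _, rfl⟩) (sq_nonneg _)
  · refine Integrable.mono' (h1'.mul_const C) ((h1'.1.mul hgm).congr (ae_of_all _ fun z => by simp))
      (ae_of_all _ fun z => ?_)
    rw [norm_mul, Real.norm_eq_abs, abs_of_nonneg (sq_nonneg _), one_mul]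
    exact mul_le_mul_of_nonneg_left (hC _ ⟨z, Set.mem_univ _, rfl⟩) (sq_nonneg _)

/-- Continuity of `(x, y) ↦ (b(y) − b(x))·∇K_ω(y − x)`. [folklore] -/
private theorem continuous_symmDrift (hb : Continuous b) (F : Finset (d → ℤ)) (ω : (d → ℤ) → ℝ) :
    Continuous fun z : UnitAddTorus d × UnitAddTorus d => ∑ a, (b z.2 a - b z.1 a) * fluxKernelGrad F ω a (z.2 - z.1) := by
  refine continuous_finsetSum _ fun a _ => ?_
  have hba : Continuous fun y : UnitAddTorus d => b y a := (PiLp.continuous_apply 2 (fun _ : d => ℝ) a).comp hb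
  exact ((hba.comp continuous_snd).sub (hba.comp continuous_fst)).mul
    ((continuous_fluxKernelGrad F ω a).comp (continuous_snd.sub continuous_fst))

/-- **Symmetrisation of the drift.**  Since the gradient kernel is odd, swapping the variables gives
`∫∫ ⟨w(x),w(y)⟩ b(y)·∇K_ω(y−x) = ½ ∫∫ ⟨w(x),w(y)⟩ (b(y) − b(x))·∇K_ω(y−x)`.
[cite: DiPernaLions1989, §II.1 Lemma II.1] -/
theorem integral_prod_drift_eq_half_symm (hw : MemLp w 2 volume) (hb : Continuous b) (F : Finset (d → ℤ))
    (ω : (d → ℤ) → ℝ) :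
    ∫ z : UnitAddTorus d × UnitAddTorus d, ⟪w z.1, w z.2⟫_ℝ * ∑ a, b z.2 a * fluxKernelGrad F ω a (z.2 - z.1) =
      1 / 2 * ∫ z : UnitAddTorus d × UnitAddTorus d,
        ⟪w z.1, w z.2⟫_ℝ * ∑ a, (b z.2 a - b z.1 a) * fluxKernelGrad F ω a (z.2 - z.1) := by
  have hba : ∀ a, Continuous fun y : UnitAddTorus d => b y a := fun a => (PiLp.continuous_apply 2 (fun _ : d => ℝ) a).comp hb
  have hg1 : Continuous fun z : UnitAddTorus d × UnitAddTorus d => ∑ a, b z.2 a * fluxKernelGrad F ω a (z.2 - z.1) :=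
    continuous_finsetSum _ fun a _ => ((hba a).comp continuous_snd).mul
      ((continuous_fluxKernelGrad F ω a).comp (continuous_snd.sub continuous_fst))
  have hg2 : Continuous fun z : UnitAddTorus d × UnitAddTorus d => ∑ a, b z.1 a * fluxKernelGrad F ω a (z.2 - z.1) :=
    continuous_finsetSum _ fun a _ => ((hba a).comp continuous_fst).mul
      ((continuous_fluxKernelGrad F ω a).comp (continuous_snd.sub continuous_fst))
  have hI1 := integrable_inner_mul hw hg1
  have hI2 := integrable_inner_mul hw hg2
  -- the swapped integral is minus the original one
  have hswap : ∫ z : UnitAddTorus d × UnitAddTorus d, ⟪w z.1, w z.2⟫_ℝ * ∑ a, b z.1 a * fluxKernelGrad F ω a (z.2 - z.1) =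
      -∫ z : UnitAddTorus d × UnitAddTorus d, ⟪w z.1, w z.2⟫_ℝ * ∑ a, b z.2 a * fluxKernelGrad F ω a (z.2 - z.1) := by
    rw [← integral_neg, Measure.volume_eq_prod,
      ← integral_prod_swap (fun z : UnitAddTorus d × UnitAddTorus d => -(⟪w z.1, w z.2⟫_ℝ * ∑ a, b z.2 a *
        fluxKernelGrad F ω a (z.2 - z.1)))]
    refine integral_congr_ae (ae_of_all _ fun z => ?_)
    simp only [Prod.fst_swap, Prod.snd_swap, real_inner_comm (w z.1), ← mul_neg, ← Finset.sum_neg_distrib]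
    congr 1
    refine Finset.sum_congr rfl fun a _ => ?_
    rw [show z.1 - z.2 = -(z.2 - z.1) by abel, fluxKernelGrad_neg]
    ring
  have hsplit : ∫ z : UnitAddTorus d × UnitAddTorus d, ⟪w z.1, w z.2⟫_ℝ * ∑ a, (b z.2 a - b z.1 a) * fluxKernelGrad F ω a (z.2 - z.1) =
      (∫ z : UnitAddTorus d × UnitAddTorus d, ⟪w z.1, w z.2⟫_ℝ * ∑ a, b z.2 a * fluxKernelGrad F ω a (z.2 - z.1)) -
        ∫ z : UnitAddTorus d × UnitAddTorus d, ⟪w z.1, w z.2⟫_ℝ * ∑ a, b z.1 a * fluxKernelGrad F ω a (z.2 - z.1) := by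
    rw [← integral_sub hI1 hI2]
    refine integral_congr_ae (ae_of_all _ fun z => ?_)
    dsimp only
    rw [← mul_sub, ← Finset.sum_sub_distrib]
    congr 1
    refine Finset.sum_congr rfl fun a _ => ?_
    ring
  rw [hsplit, hswap]
  ring

/-- **The divergence-free drift pairs to zero with the gradient kernel**: for `b` continuous and weakly
divergence free, `∫ Σ_a b_a(y) ∇K_ω(y − x)_a dy = 0` for every `x` (`∫ b·∇θ = 0` with `θ = K_ω(· − x)`; on the
Fourier side `Σ_a k_a b̂_a(−k) = 0`). [cite: DiPernaLions1989, §II.1 Lemma II.1] -/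
theorem integral_sum_mul_fluxKernelGrad_sub_eq_zero (hb : Continuous b) (hdiv : IsWeaklyDivFree b)
    (F : Finset (d → ℤ)) (ω : (d → ℤ) → ℝ) (x : UnitAddTorus d) :
    ∫ y, ∑ a, b y a * fluxKernelGrad F ω a (y - x) = 0 := by
  classical
  have hbi : Integrable b volume := hb.integrable_of_hasCompactSupport (HasCompactSupport.of_compactSpace _)
  have hb2 : MemLp b 2 volume := hb.memLp_of_hasCompactSupport (HasCompactSupport.of_compactSpace _)
  have hba : ∀ a, Continuous fun y : UnitAddTorus d => b y a := fun a => (PiLp.continuous_apply 2 (fun _ : d => ℝ) a).comp hb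
  -- the transversality of the coefficients of `b`
  have hmode : ∀ k : d → ℤ, ∑ a, (2 * Real.pi * I * (k a : ℂ)) * ∫ y, mFourier k y * ((b y a : ℝ) : ℂ) = 0 := by
    intro k
    have hco : ∀ a, ∫ y, mFourier k y * ((b y a : ℝ) : ℂ) = mFourierCoeff (EuclideanSpace.complexify ∘ b) (-k) a := by
      intro a
      rw [← integral_mFourier_neg_mul_coord hbi (-k) a, neg_neg]
    simp_rw [hco]
    have h := hdiv.sum_mul_mFourierCoeff_eq_zero hb2 (-k)
    have e : ∑ a, 2 * Real.pi * I * (k a : ℂ) * mFourierCoeff (EuclideanSpace.complexify ∘ b) (-k) a =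
        -(2 * Real.pi * I) * ∑ a, ((-k) a : ℂ) * mFourierCoeff (EuclideanSpace.complexify ∘ b) (-k) a := by
      rw [Finset.mul_sum]
      refine Finset.sum_congr rfl fun a _ => ?_
      simp only [Pi.neg_apply, Int.cast_neg]
      ring
    rw [e, h, mul_zero]
  -- pointwise rewriting of the integrand
  have hpt : ∀ y, ∑ a, b y a * fluxKernelGrad F ω a (y - x) =
      ∑ k ∈ F, ω k * (mFourier (-k) x * ∑ a, (2 * Real.pi * I * (k a : ℂ)) * (mFourier k y * ((b y a : ℝ) : ℂ))).re := by
    intro y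
    simp only [fluxKernelGrad, Finset.mul_sum, Complex.re_sum]
    rw [Finset.sum_comm]
    refine Finset.sum_congr rfl fun k _ => Finset.sum_congr rfl fun a _ => ?_
    rw [mFourier_sub_eq k x y]
    have e : 2 * Real.pi * I * (k a : ℂ) * (mFourier k y * mFourier (-k) x) =
        mFourier (-k) x * (2 * Real.pi * I * (k a : ℂ) * mFourier k y) := by ring
    rw [e, show mFourier (-k) x * (2 * Real.pi * I * (k a : ℂ) * (mFourier k y * ((b y a : ℝ) : ℂ))) =
      ((b y a : ℝ) : ℂ) * (mFourier (-k) x * (2 * Real.pi * I * (k a : ℂ) * mFourier k y)) by ring, Complex.re_ofReal_mul]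
    ring
  simp_rw [hpt]
  have hint : ∀ k a, Integrable (fun y : UnitAddTorus d => mFourier k y * ((b y a : ℝ) : ℂ)) volume := fun k a =>
    ((mFourier k).continuous.mul (Complex.continuous_ofReal.comp (hba a))).integrable_of_hasCompactSupport
      (HasCompactSupport.of_compactSpace _)
  have hint2 : ∀ k, Integrable (fun y : UnitAddTorus d => mFourier (-k) x *
      ∑ a, (2 * Real.pi * I * (k a : ℂ)) * (mFourier k y * ((b y a : ℝ) : ℂ))) volume := fun k =>
    (integrable_finsetSum _ fun a _ => (hint k a).const_mul _).const_mul _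
  have hint3 : ∀ k, Integrable (fun y : UnitAddTorus d => ω k * (mFourier (-k) x *
      ∑ a, (2 * Real.pi * I * (k a : ℂ)) * (mFourier k y * ((b y a : ℝ) : ℂ))).re) volume := fun k => by
    simpa using ((hint2 k).re).const_mul (ω k)
  rw [integral_finsetSum _ fun k _ => hint3 k]
  refine Finset.sum_eq_zero fun k _ => ?_
  have hre := integral_re (hint2 k)
  simp only [RCLike.re_to_complex] at hre
  rw [integral_const_mul, hre, integral_const_mul, integral_finsetSum _ fun a _ => (hint k a).const_mul _]
  simp_rw [integral_const_mul]
  rw [hmode k, mul_zero, Complex.zero_re, mul_zero]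

/-- The symmetrised drift integrates to zero against `‖w(x)‖²` and against `‖w(y)‖²` (divergence-free drift,
zero-mean odd kernel). [cite: DiPernaLions1989, §II.1 Lemma II.1] -/
theorem integral_prod_norm_sq_mul_symmDrift_eq_zero (hw : MemLp w 2 volume) (hb : Continuous b) (hdiv : IsWeaklyDivFree b)
    (F : Finset (d → ℤ)) (ω : (d → ℤ) → ℝ) :
    (∫ z : UnitAddTorus d × UnitAddTorus d, ‖w z.1‖ ^ 2 * ∑ a, (b z.2 a - b z.1 a) * fluxKernelGrad F ω a (z.2 - z.1)) = 0 ∧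
      (∫ z : UnitAddTorus d × UnitAddTorus d, ‖w z.2‖ ^ 2 * ∑ a, (b z.2 a - b z.1 a) * fluxKernelGrad F ω a (z.2 - z.1)) = 0 := by
  have hba : ∀ a, Continuous fun y : UnitAddTorus d => b y a := fun a => (PiLp.continuous_apply 2 (fun _ : d => ℝ) a).comp hb
  have hg := continuous_symmDrift hb F ω
  obtain ⟨hI1, hI2⟩ := integrable_norm_sq_mul hw hg
  -- the inner integrals vanish
  have hcI : ∀ {f : UnitAddTorus d → ℝ}, Continuous f → Integrable f volume := fun hf =>
    hf.integrable_of_hasCompactSupport (HasCompactSupport.of_compactSpace _)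
  have hinner1 : ∀ x, ∫ y, ∑ a, (b y a - b x a) * fluxKernelGrad F ω a (y - x) = 0 := by
    intro x
    have e : ∀ y, ∑ a, (b y a - b x a) * fluxKernelGrad F ω a (y - x) =
        (∑ a, b y a * fluxKernelGrad F ω a (y - x)) - ∑ a, b x a * fluxKernelGrad F ω a (y - x) := by
      intro y; rw [← Finset.sum_sub_distrib]; refine Finset.sum_congr rfl fun a _ => ?_; ring
    simp_rw [e]
    have hf1 : Integrable (fun y => ∑ a, b y a * fluxKernelGrad F ω a (y - x)) volume :=
      hcI (continuous_finsetSum _ fun a _ => (hba a).mul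
        ((continuous_fluxKernelGrad F ω a).comp (continuous_id.sub continuous_const)))
    have hf2a : ∀ a, Integrable (fun y => b x a * fluxKernelGrad F ω a (y - x)) volume := fun a =>
      hcI (continuous_const.mul ((continuous_fluxKernelGrad F ω a).comp (continuous_id.sub continuous_const)))
    have hf2 : Integrable (fun y => ∑ a, b x a * fluxKernelGrad F ω a (y - x)) volume :=
      integrable_finsetSum _ fun a _ => hf2a a
    rw [integral_sub hf1 hf2, integral_sum_mul_fluxKernelGrad_sub_eq_zero hb hdiv F ω x, zero_sub, neg_eq_zero,
      integral_finsetSum _ fun a _ => hf2a a]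
    refine Finset.sum_eq_zero fun a _ => ?_
    rw [integral_const_mul, integral_sub_right_eq_self (fun z => fluxKernelGrad F ω a z) x, integral_fluxKernelGrad,
      mul_zero]
  have hinner2 : ∀ y, ∫ x, ∑ a, (b y a - b x a) * fluxKernelGrad F ω a (y - x) = 0 := by
    intro y
    -- `∇K(y − x) = −∇K(x − y)`, reducing to `hinner1` at the point `y` and the zero mean
    have e : ∀ x, ∑ a, (b y a - b x a) * fluxKernelGrad F ω a (y - x) =
        (∑ a, b x a * fluxKernelGrad F ω a (x - y)) - ∑ a, b y a * fluxKernelGrad F ω a (x - y) := by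
      intro x; rw [← Finset.sum_sub_distrib]; refine Finset.sum_congr rfl fun a _ => ?_
      rw [show y - x = -(x - y) by abel, fluxKernelGrad_neg]; ring
    simp_rw [e]
    have hf1 : Integrable (fun x => ∑ a, b x a * fluxKernelGrad F ω a (x - y)) volume :=
      hcI (continuous_finsetSum _ fun a _ => (hba a).mul
        ((continuous_fluxKernelGrad F ω a).comp (continuous_id.sub continuous_const)))
    have hf2a : ∀ a, Integrable (fun x => b y a * fluxKernelGrad F ω a (x - y)) volume := fun a =>
      hcI (continuous_const.mul ((continuous_fluxKernelGrad F ω a).comp (continuous_id.sub continuous_const)))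
    have hf2 : Integrable (fun x => ∑ a, b y a * fluxKernelGrad F ω a (x - y)) volume :=
      integrable_finsetSum _ fun a _ => hf2a a
    rw [integral_sub hf1 hf2, integral_sum_mul_fluxKernelGrad_sub_eq_zero hb hdiv F ω y, zero_sub, neg_eq_zero,
      integral_finsetSum _ fun a _ => hf2a a]
    refine Finset.sum_eq_zero fun a _ => ?_
    rw [integral_const_mul, integral_sub_right_eq_self (fun z => fluxKernelGrad F ω a z) y, integral_fluxKernelGrad,
      mul_zero]
  constructor
  · rw [Measure.volume_eq_prod, integral_prod _ (Measure.volume_eq_prod (α := UnitAddTorus d) (β := UnitAddTorus d) ▸ hI1)]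
    simp only
    simp_rw [integral_const_mul, hinner1, mul_zero, integral_zero]
  · rw [Measure.volume_eq_prod, integral_prod_symm _ (Measure.volume_eq_prod (α := UnitAddTorus d) (β := UnitAddTorus d) ▸ hI2)]
    simp only
    simp_rw [integral_const_mul, hinner2, mul_zero, integral_zero]

/-- **THE DOUBLE-DIFFERENCE FORM of the weighted transport flux** (Constantin–E–Titi / DiPerna–Lions structure for
a Fourier cutoff): for `w ∈ L²`, `b` continuous and weakly divergence free,
`Σ_k ω_k Re Σ_a 2πi k_a ⟪𝓕(b_a w)(k), ŵ(k)⟫ = −¼ ∫∫ |w(x) − w(y)|² (b(y) − b(x))·∇K_ω(y − x) dx dy`.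
[cite: ConstantinETiti1994, (9)–(10)] [cite: DiPernaLions1989, §II.1 Lemma II.1] -/
theorem weightedFlux_eq_neg_quarter_integral (hw : MemLp w 2 volume) (hb : Continuous b) (hdiv : IsWeaklyDivFree b)
    (F : Finset (d → ℤ)) (ω : (d → ℤ) → ℝ) :
    ∑ k ∈ F, ω k * (∑ a, (2 * Real.pi * I * (k a : ℂ)) *
        ⟪mFourierCoeff (EuclideanSpace.complexify ∘ fun x => b x a • w x) k,
          mFourierCoeff (EuclideanSpace.complexify ∘ w) k⟫_ℂ).re =
      -(1 / 4) * ∫ z : UnitAddTorus d × UnitAddTorus d,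
        ‖w z.1 - w z.2‖ ^ 2 * ∑ a, (b z.2 a - b z.1 a) * fluxKernelGrad F ω a (z.2 - z.1) := by
  rw [weightedFlux_eq_integral_prod hw hb, integral_prod_drift_eq_half_symm hw hb]
  have hg := continuous_symmDrift hb F ω
  obtain ⟨hI1, hI2⟩ := integrable_norm_sq_mul hw hg
  have hI := integrable_inner_mul hw hg
  obtain ⟨h1, h2⟩ := integral_prod_norm_sq_mul_symmDrift_eq_zero hw hb hdiv F ω
  -- polarisation `⟨u, v⟩ = ½(‖u‖² + ‖v‖² − ‖u − v‖²)` under the integral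
  have e : ∫ z : UnitAddTorus d × UnitAddTorus d, ⟪w z.1, w z.2⟫_ℝ * ∑ a, (b z.2 a - b z.1 a) * fluxKernelGrad F ω a (z.2 - z.1) =
      1 / 2 * ((∫ z : UnitAddTorus d × UnitAddTorus d, ‖w z.1‖ ^ 2 * ∑ a, (b z.2 a - b z.1 a) * fluxKernelGrad F ω a (z.2 - z.1)) +
        (∫ z : UnitAddTorus d × UnitAddTorus d, ‖w z.2‖ ^ 2 * ∑ a, (b z.2 a - b z.1 a) * fluxKernelGrad F ω a (z.2 - z.1)) -
        ∫ z : UnitAddTorus d × UnitAddTorus d, ‖w z.1 - w z.2‖ ^ 2 * ∑ a, (b z.2 a - b z.1 a) * fluxKernelGrad F ω a (z.2 - z.1)) := by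
    have hI3 : Integrable (fun z : UnitAddTorus d × UnitAddTorus d =>
        ‖w z.1 - w z.2‖ ^ 2 * ∑ a, (b z.2 a - b z.1 a) * fluxKernelGrad F ω a (z.2 - z.1)) volume := by
      have e3 : (fun z : UnitAddTorus d × UnitAddTorus d =>
          ‖w z.1 - w z.2‖ ^ 2 * ∑ a, (b z.2 a - b z.1 a) * fluxKernelGrad F ω a (z.2 - z.1)) =
          fun z => (‖w z.1‖ ^ 2 * ∑ a, (b z.2 a - b z.1 a) * fluxKernelGrad F ω a (z.2 - z.1)) +
            (‖w z.2‖ ^ 2 * ∑ a, (b z.2 a - b z.1 a) * fluxKernelGrad F ω a (z.2 - z.1)) -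
            2 * (⟪w z.1, w z.2⟫_ℝ * ∑ a, (b z.2 a - b z.1 a) * fluxKernelGrad F ω a (z.2 - z.1)) := by
        funext z; rw [norm_sub_sq_real]; ring
      rw [e3]
      exact (hI1.add hI2).sub (hI.const_mul 2)
    have hI12 : Integrable (fun z : UnitAddTorus d × UnitAddTorus d =>
        ‖w z.1‖ ^ 2 * (∑ a, (b z.2 a - b z.1 a) * fluxKernelGrad F ω a (z.2 - z.1)) +
          ‖w z.2‖ ^ 2 * ∑ a, (b z.2 a - b z.1 a) * fluxKernelGrad F ω a (z.2 - z.1)) volume := hI1.add hI2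
    calc ∫ z : UnitAddTorus d × UnitAddTorus d, ⟪w z.1, w z.2⟫_ℝ * ∑ a, (b z.2 a - b z.1 a) * fluxKernelGrad F ω a (z.2 - z.1)
        = ∫ z : UnitAddTorus d × UnitAddTorus d, 1 / 2 *
            ((‖w z.1‖ ^ 2 * (∑ a, (b z.2 a - b z.1 a) * fluxKernelGrad F ω a (z.2 - z.1)) +
              ‖w z.2‖ ^ 2 * ∑ a, (b z.2 a - b z.1 a) * fluxKernelGrad F ω a (z.2 - z.1)) -
              ‖w z.1 - w z.2‖ ^ 2 * ∑ a, (b z.2 a - b z.1 a) * fluxKernelGrad F ω a (z.2 - z.1)) := by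
          refine integral_congr_ae (ae_of_all _ fun z => ?_)
          dsimp only
          rw [norm_sub_sq_real]
          ring
      _ = _ := by
          rw [integral_const_mul, integral_sub hI12 hI3, integral_add hI1 hI2]
  rw [e, h1, h2]
  ring

end Symm

end Torus

end Literature.Analysis.FunctionSpaces

end
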